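import Mathlib

/-!
# Route BarrierLever — item `PartitionMinorsHitByVP` (stmt-ValiantsHypothesis-19717), line `hidden-states`:
# THE THREE-MOVER CHAIN IDENTITY (pure algebra) — toolkit for the chain lemma `…SecondShellChainThree`

Helper file (`--supports stmt-ValiantsHypothesis-19717`; cell valiant-natproofs, 𝒟-side door (c), registered line
`Cruxes/PartitionMinorsHitByVP/Lines/hidden_states.lean` v8; prover seat val-np-p6 gen 18).  Closes NO item; definition-free.

CONTENTS.  (1) `det_eq_zero_of_row_mem_span` — a row in the span of the other rows kills the determinant (the form in which
all CANCELLATION cells are applied: a relation given piecewise as a sum of sums, no global coefficient vector needed).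
(2) ★ `chain₃_column_identity` — the budget-two expansion of `Y_a Y_b Y_c` for a CHAIN of three movers `c → b → a` with
SYMBOLIC weights: constants `a₀, b₀, c₀` (what the movers read inside the inert block), path weights `σ` (`b` reads `a`),
`τ` (`c` reads `b`), and for every read exit `d` the weights `α_d, β_d, γ_d`; on a column meeting at most two free nodes
(`|JD| + n_a + n_b + n_c ≤ 2`) the product is the explicit combination
`λ_∅ + λ_a Y_a + λ_b Y_b + λ_c Y_c + λ_{ab} Y_aY_b + λ_{ac} Y_aY_c + λ_{bc} Y_bY_c + Σ_d (λ_d + λ_{ad} Y_a + λ_{bd} Y_b + λ_{cd} Y_c)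
 + στ((Σ_d α_d)² − Σ_d α_d²)` — the last term says: the only pure-exit pairs are pairs of `a`-exits, coefficient `2στ α_d α_{d'}`.
Found with generic-weight elimination (lab/pn_expand*.py, this seat; lab/expandg.py of gen 17) and checked here by `ring` in the
twelve budget cases; it specialises to gen 17's `nested_budget_identity` / `…'` / `…₂` / `…_shared`.

HONEST LABEL: conjecture-column toolkit (second shell, every `t, h`); 19717 stays OPEN; nothing on crux 14610 or VP ≠ VNP.
-/

set_option linter.dupNamespace false

namespace Summit.ValiantsHypothesis.ValiantsHypothesis.Theorems.BarrierLever.HiddenStates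

open Finset

noncomputable section

namespace SecondShell

/-! ## A row in the span of the other rows kills the determinant -/

/-- if row `i₀` lies in the span of the other rows, the determinant vanishes. -/
theorem det_eq_zero_of_row_mem_span {r : ℕ} (Mx : Matrix (Fin r) (Fin r) ℂ) (i₀ : Fin r)
    (h : Mx i₀ ∈ Submodule.span ℂ (Mx '' {i | i ≠ i₀})) : Mx.det = 0 := by
  apply Matrix.det_eq_zero_of_not_linearIndependent_rows
  intro hli
  exact hli.notMem_span_image (s := {i | i ≠ i₀}) (by simp) h

/-! ## The three-mover chain identity on a budget-two column (pure algebra) -/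

/-- ★ the budget-two expansion of `Y_a Y_b Y_c` for a chain `c → b → a` with symbolic exit weights: on a column meeting at most
two of the free nodes (movers `a, b, c` with indicators `n_•`, read exits `JD`), `Y_a = n_a + a₀ + Σ α`, `Y_b = n_b + σ n_a + b₀ + Σ β`,
`Y_c = n_c + τ n_b + c₀ + Σ γ`. -/
theorem chain₃_column_identity {β : Type*} [DecidableEq β] (JD : Finset β) (αw βw γw : β → ℂ)
    (a₀ b₀ c₀ σ τ : ℂ) (na nb nc : ℕ) (hna : na = 0 ∨ na = 1) (hnb : nb = 0 ∨ nb = 1) (hnc : nc = 0 ∨ nc = 1)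
    (hbudget : JD.card + na + nb + nc ≤ 2) (Ya Yb Yc : ℂ)
    (hYa : Ya = na + a₀ + ∑ d ∈ JD, αw d) (hYb : Yb = nb + σ * na + b₀ + ∑ d ∈ JD, βw d)
    (hYc : Yc = nc + τ * nb + c₀ + ∑ d ∈ JD, γw d) :
    Ya * Yb * Yc = a₀ * (b₀ + σ) * (c₀ + τ) - (b₀ + σ) * (c₀ + τ) * Ya - a₀ * (c₀ + τ) * Yb - a₀ * (b₀ + σ) * Yc
      + (c₀ + τ) * (Ya * Yb) + (b₀ + σ) * (Ya * Yc) + a₀ * (Yb * Yc)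
      + ∑ d ∈ JD, ((-2 * αw d * βw d * γw d - c₀ * αw d * βw d - b₀ * αw d * γw d - a₀ * βw d * γw d
          + τ * a₀ * βw d + σ * c₀ * αw d + σ * τ * αw d * (1 + αw d + a₀))
        + (βw d * γw d - τ * βw d - σ * τ * αw d) * Ya + (αw d * γw d) * Yb + (αw d * βw d - σ * αw d) * Yc)
      + σ * τ * ((∑ d ∈ JD, αw d) ^ 2 - ∑ d ∈ JD, (αw d) ^ 2) := by
  rcases Nat.lt_or_ge JD.card 1 with h0 | h1
  · have hJD : JD = ∅ := Finset.card_eq_zero.1 (show JD.card = 0 by omega)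
    subst hJD
    simp only [Finset.sum_empty, add_zero] at hYa hYb hYc ⊢
    subst hYa hYb hYc
    rcases hna with rfl | rfl <;> rcases hnb with rfl | rfl <;> rcases hnc with rfl | rfl <;>
      first | (exfalso; omega) | (push_cast; ring)
  · rcases Nat.lt_or_ge JD.card 2 with h1' | h2
    · obtain ⟨d, hJD⟩ := Finset.card_eq_one.1 (show JD.card = 1 by omega)
      subst hJD
      rw [Finset.card_singleton] at hbudget
      simp only [Finset.sum_singleton] at hYa hYb hYc ⊢
      subst hYa hYb hYc
      rcases hna with rfl | rfl <;> rcases hnb with rfl | rfl <;> rcases hnc with rfl | rfl <;>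
        first | (exfalso; omega) | (push_cast; ring)
    · obtain ⟨d, d', hdd, hJD⟩ := Finset.card_eq_two.1 (show JD.card = 2 by omega)
      subst hJD
      rw [Finset.card_pair hdd] at hbudget
      obtain ⟨rfl, rfl, rfl⟩ : na = 0 ∧ nb = 0 ∧ nc = 0 := by omega
      simp only [Finset.sum_pair hdd] at hYa hYb hYc ⊢
      subst hYa hYb hYc
      push_cast; ring

end SecondShell

end

end Summit.ValiantsHypothesis.ValiantsHypothesis.Theorems.BarrierLever.HiddenStates
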